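import Summits.ResolutionOfSingularities.ResolutionOfSingularities.Theorems.FrobeniusClosingPatchingRelPerfectTwoPlanesChartThreeIdeals
import Summits.ResolutionOfSingularities.ResolutionOfSingularities.Theorems.FrobeniusClosingPatchingRelPerfectTwoPlanesPointQCharts
import Summits.ResolutionOfSingularities.ResolutionOfSingularities.Theorems.FrobeniusClosingPatchingRelPerfectTwoPlanesPlanePow
import HarnessLib

/-!
# Crux `PatchingRelPerfect` (stmt-ResolutionOfSingularities-16161), chain w52 — the rank-two member
# `f = x₀x₁ + x₂³`: the chart `B₃` of `Bl_𝔪` is resolved by the twice-repaired companion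

[OURS · L1 W5.2 · rung, design note NEXT-two-planes-cube.md Addenda 8–12, kit j286610 / j288133]
On `B₃ = S[x/x₃]` the image of `𝔪ᴺ·A·J_q′·J_π·A₃·A₄·I` is `(u^{N+11})·((J₃·J_q♯·K_π)·(u,e₀))`
(`…ChartThreeIdeals`).  Blowing up the plane `(u, e₀)`: the `t`-chart is the old letter tower
(`…TwoPlanesLevelTwo`, after the Cartier twist `(w)³`); the `s`-chart `C₀` carries
`(w₀⁶)·((P_π · (h″, w₀)²)·𝔪_q)` and is the POINT STEP of `…TwoPlanesPointQCharts`, fed by the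
coordinate model `C₀/(w₀) ≅ (B₃/(u,e₀))[S] ≅ κ[S, T₁, T₂]` (`exists_pointQModelHom_three`:
`s ↦ S`, `e₁ ↦ T₁`, `e₂ ↦ T₂`).  PROVED: `isRegular_of_isBlowup_tpAllPi_three` — **every blowing up
of `Spec B₃` along the image of `𝔪ᴺ·A·J_q′·J_π·A₃·A₄·I` is regular.**

Nothing here is a statement of the manuscript under review.

## References

* The Stacks Project, Tags 080A, 080B, 0804, 0BIQ. [StacksProject]
* Q. Liu, *Algebraic Geometry and Arithmetic Curves*, OUP 2002, Thm. 8.1.19 (a). [Liu2002]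
* U. Görtz, T. Wedhorn, *Algebraic Geometry I*, 2nd ed. 2020, Prop. 13.96 (2). [GortzWedhorn2020]
-/

-- `Summit.<Summit>.<Sub>.Theorems` with `Sub = Summit` (single-conjunct summit, D-0017)
set_option linter.dupNamespace false

noncomputable section

open CategoryTheory CategoryTheory.Limits AlgebraicGeometry Literature.AlgebraicGeometry.Resolution
open IsLocalRing

namespace Summit.ResolutionOfSingularities.ResolutionOfSingularities.Theorems

namespace TwoPlanesRung

open ConeRung

universe u

/-- A three-member family with pairwise distinct members is injective. [folklore] -/
theorem injective_cons_three {α : Type*} (c₀ c₁ c₂ : α) (h01 : c₀ ≠ c₁) (h02 : c₀ ≠ c₂) (h12 : c₁ ≠ c₂) :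
    Function.Injective (Fin.cons c₀ (Fin.cons c₁ (Fin.cons c₂ Fin.elim0 : Fin 1 → α) : Fin 2 → α) : Fin 3 → α) := by
  refine Fin.cons_injective_iff.mpr ⟨?_, Fin.cons_injective_iff.mpr ⟨?_, Fin.cons_injective_iff.mpr ⟨?_,
    Function.injective_of_subsingleton _⟩⟩⟩
  · rw [Fin.range_cons, Fin.range_cons]
    rintro (h | h | ⟨k, -⟩)
    · exact h01 h
    · exact h02 h
    · exact k.elim0
  · rw [Fin.range_cons]
    rintro (h | ⟨k, -⟩)
    · exact h12 h
    · exact k.elim0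
  · rintro ⟨k, -⟩; exact k.elim0

/-- `1 ≠ 3` and `2 ≠ 3` in `Fin 4`. [folklore] -/
theorem three_facts : (1 : Fin 4) ≠ 3 ∧ (2 : Fin 4) ≠ 3 := by decide

/-- `3 ≠ 0`, `3 ≠ 1` in `Fin 4`. [folklore] -/
theorem three_ne_zero_one : (3 : Fin 4) ≠ 0 ∧ (3 : Fin 4) ≠ 1 := by decide

section ChartThree

variable {S : Type u} [CommRing S] [IsRegularLocalRing S] (x : Fin 4 → S)
  (hx : Ideal.span (Set.range x) = IsLocalRing.maximalIdeal S)
  (hd : (IsLocalRing.maximalIdeal S).spanFinrank = 4)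

local notation3 (prettyPrint := false) "M" => Ideal.span (Set.range x)
local notation3 (prettyPrint := false) "fT" => x 0 * x 1 + x 2 ^ 3
local notation3 (prettyPrint := false) "B" => chartRing x 3
local notation3 (prettyPrint := false) "uB" => chartBase x 3 (x 3)
local notation3 (prettyPrint := false) "e[" j "]" => chartGen x 3 j
local notation3 (prettyPrint := false) "U" => Ideal.span {chartBase x 3 (x 3)}
local notation3 (prettyPrint := false) "cc" => (Fin.cons (chartBase x 3 (x 3)) (fun _ : Fin 1 => chartGen x 3 0) : Fin 2 → chartRing x 3)
local notation3 (prettyPrint := false) "II" => Ideal.span (Set.range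
  (Fin.cons (chartBase x 3 (x 3)) (fun _ : Fin 1 => chartGen x 3 0) : Fin 2 → chartRing x 3))
local notation3 (prettyPrint := false) "J" => Ideal.span {chartGen x 3 0 * chartGen x 3 1, chartBase x 3 (x 3)} *
    (Ideal.span {chartGen x 3 0 * chartGen x 3 1 + chartBase x 3 (x 3) * chartGen x 3 2 ^ 3} ⊔
      Ideal.span {chartBase x 3 (x 3)} * Ideal.span {chartGen x 3 0} ⊔ Ideal.span {chartBase x 3 (x 3)} ^ 2) *
    (Ideal.span {chartGen x 3 0 * chartGen x 3 1 + chartBase x 3 (x 3) * chartGen x 3 2 ^ 3} ⊔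
      Ideal.span {chartBase x 3 (x 3)} ^ 2)
local notation3 (prettyPrint := false) "Jq₃" => Ideal.span {chartGen x 3 0} ⊔
  Ideal.span {chartBase x 3 (x 3)} * Ideal.span {chartGen x 3 1, chartGen x 3 2} ⊔ Ideal.span {chartBase x 3 (x 3)} ^ 2
local notation3 (prettyPrint := false) "Kpi₃" =>
  Ideal.span {chartGen x 3 0, chartBase x 3 (x 3) * chartGen x 3 1, chartBase x 3 (x 3) * chartGen x 3 2} ^ 2 ⊔
    Ideal.span {chartBase x 3 (x 3)} ^ 3
local notation3 (prettyPrint := false) "tpJq'" => (Ideal.span {x 0} ⊔ Ideal.span {x 1, x 2} * Ideal.span {x 1, x 2, x 3} ⊔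
  Ideal.span {x 3 ^ 3}) ⊔ Ideal.span (Set.range x) ^ 3
local notation3 (prettyPrint := false) "tpJpi" => Ideal.span {x 0, x 1 * x 3, x 2 * x 3} ^ 2 ⊔
  Ideal.span {x 0 * x 1 ^ 2, x 0 * x 2 ^ 2, x 1 ^ 4, x 2 ^ 4, x 3 ^ 5} ⊔ Ideal.span (Set.range x) ^ 5
/-- the `s`-chart `C₀` of the plane step and its coordinates -/
local notation3 (prettyPrint := false) "C₀" => chartRing (Fin.cons (chartBase x 3 (x 3)) (fun _ : Fin 1 => chartGen x 3 0) : Fin 2 → chartRing x 3) 0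
local notation3 (prettyPrint := false) "ψ₀" => chartBase (Fin.cons (chartBase x 3 (x 3)) (fun _ : Fin 1 => chartGen x 3 0) : Fin 2 → chartRing x 3) 0
local notation3 (prettyPrint := false) "w₀" => chartBase (Fin.cons (chartBase x 3 (x 3)) (fun _ : Fin 1 => chartGen x 3 0) : Fin 2 → chartRing x 3) 0
  ((Fin.cons (chartBase x 3 (x 3)) (fun _ : Fin 1 => chartGen x 3 0) : Fin 2 → chartRing x 3) 0)
local notation3 (prettyPrint := false) "ss" => chartGen (Fin.cons (chartBase x 3 (x 3)) (fun _ : Fin 1 => chartGen x 3 0) : Fin 2 → chartRing x 3) 0 1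
/-- the coefficient field and the variable sets of the model `κ[S, T₁, T₂]` -/
local notation3 (prettyPrint := false) "κ'" => S ⧸ (Ideal.span (Set.range x) ⊔ ⊥)
local notation3 (prettyPrint := false) "σ₀" => {j : Fin 2 // j ≠ 0}
local notation3 (prettyPrint := false) "σ₃" => {j : Fin 4 // j ≠ (3 : Fin 4) ∧ j ∉ ({0} : Set (Fin 4))}
local notation3 (prettyPrint := false) "τ" => ({j : Fin 2 // j ≠ 0} ⊕ {j : Fin 4 // j ≠ (3 : Fin 4) ∧ j ∉ ({0} : Set (Fin 4))})
/-- the three target variables `S`, `T₁`, `T₂` -/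
local notation3 (prettyPrint := false) "vS" => (Sum.inl ⟨1, one_ne_zero_fin2⟩ : {j : Fin 2 // j ≠ 0} ⊕ {j : Fin 4 // j ≠ (3 : Fin 4) ∧ j ∉ ({0} : Set (Fin 4))})
local notation3 (prettyPrint := false) "vT1" => (Sum.inr ⟨1, three_facts.1, one_notMem_zero_set⟩ : {j : Fin 2 // j ≠ 0} ⊕ {j : Fin 4 // j ≠ (3 : Fin 4) ∧ j ∉ ({0} : Set (Fin 4))})
local notation3 (prettyPrint := false) "vT2" => (Sum.inr ⟨2, three_facts.2, two_notMem_zero_set⟩ : {j : Fin 2 // j ≠ 0} ⊕ {j : Fin 4 // j ≠ (3 : Fin 4) ∧ j ∉ ({0} : Set (Fin 4))})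

include hx hd in
/-- The combined model `(B₃/(u,e₀))[S] ≅ κ[S, T₁, T₂]` with its values on `S`, `ē₁`, `ē₂`.
[cite: StacksProject, Tag 0BIQ] -/
theorem exists_sModelE_three :
    ∃ E : MvPolynomial σ₀ (B ⧸ II) ≃+* MvPolynomial τ κ',
      (∀ j : σ₀, E (MvPolynomial.X j) = MvPolynomial.X (Sum.inl j)) ∧
      E (MvPolynomial.C (Ideal.Quotient.mk II e[1])) = MvPolynomial.X vT1 ∧
      E (MvPolynomial.C (Ideal.Quotient.mk II e[2])) = MvPolynomial.X vT2 := by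
  classical
  obtain ⟨ε, hε⟩ := exists_planeModelEquiv x hx hd 3 three_ne_zero_one.1
  refine ⟨(MvPolynomial.mapEquiv σ₀ ε).trans (MvPolynomial.sumAlgEquiv κ' σ₀ σ₃).symm.toRingEquiv,
    fun j => ?_, ?_, ?_⟩
  · change (MvPolynomial.sumAlgEquiv κ' σ₀ σ₃).symm (MvPolynomial.mapEquiv σ₀ ε (MvPolynomial.X j)) = _
    rw [MvPolynomial.mapEquiv_apply, MvPolynomial.map_X, MvPolynomial.sumAlgEquiv_symm_X]
  · change (MvPolynomial.sumAlgEquiv κ' σ₀ σ₃).symm (MvPolynomial.mapEquiv σ₀ ε (MvPolynomial.C _)) = _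
    rw [MvPolynomial.mapEquiv_apply, MvPolynomial.map_C, RingHom.coe_coe, hε 1 three_facts.1 one_notMem_zero_set,
      MvPolynomial.sumAlgEquiv_symm_C_X]
  · change (MvPolynomial.sumAlgEquiv κ' σ₀ σ₃).symm (MvPolynomial.mapEquiv σ₀ ε (MvPolynomial.C _)) = _
    rw [MvPolynomial.mapEquiv_apply, MvPolynomial.map_C, RingHom.coe_coe, hε 2 three_facts.2 two_notMem_zero_set,
      MvPolynomial.sumAlgEquiv_symm_C_X]

omit [IsRegularLocalRing S] in
/-- The chart model `chartQuotEquiv` read backwards: `s̄ ↦ S`, `ψ₀(r) ↦ C r̄`. [cite: StacksProject, Tag 0BIQ] -/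
theorem chartQuotEquiv_symm_values (hc : IsQuasiRegular cc) :
    (chartQuotEquiv cc 0 hc).symm (Ideal.Quotient.mk _ ss) = MvPolynomial.X ⟨1, one_ne_zero_fin2⟩ ∧
      ∀ r : B, (chartQuotEquiv cc 0 hc).symm (Ideal.Quotient.mk _ (ψ₀ r)) = MvPolynomial.C (Ideal.Quotient.mk II r) := by
  refine ⟨?_, fun r => ?_⟩
  · rw [RingEquiv.symm_apply_eq]
    exact (chartQuotMap_X cc 0 ⟨1, one_ne_zero_fin2⟩).symm
  · rw [RingEquiv.symm_apply_eq]
    exact (chartQuotMap_C cc 0 r).symm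

set_option maxHeartbeats 800000 in
include hx hd in
/-- **The coordinate model of `C₀/(w₀)`** (heartbeats: instance synthesis on the doubly nested chart
ring is allocation-heavy): a surjection `q : C₀ ↠ κ[S, T₁, T₂]` with kernel `(w₀)`,
`s ↦ S`, `ψ₀(e₁) ↦ T₁`, `ψ₀(e₂) ↦ T₂`. [cite: StacksProject, Tag 0BIQ] -/
theorem exists_pointQModelHom_three :
    ∃ q : C₀ →+* MvPolynomial τ κ', Function.Surjective q ∧ RingHom.ker q = Ideal.span {w₀} ∧
      q ss = MvPolynomial.X vS ∧ q (ψ₀ e[1]) = MvPolynomial.X vT1 ∧ q (ψ₀ e[2]) = MvPolynomial.X vT2 := by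
  haveI : IsDomain S := isDomain_of_isRegularLocalRing S
  have hc : IsQuasiRegular cc :=
    isQuasiRegular_cons_chartGen x 3 (fun _ : Fin 1 => (⟨0, three_ne_zero_one.1.symm⟩ : {j : Fin 4 // j ≠ 3}))
      (isQuasiRegular_regularSystemOfParameters hd x hx) (Function.injective_of_subsingleton _)
  obtain ⟨E, hEX, hE1, hE2⟩ := exists_sModelE_three x hx hd
  obtain ⟨hθs, hθr⟩ := chartQuotEquiv_symm_values x hc
  let Θ : (C₀ ⧸ Ideal.span {w₀}) ≃+* MvPolynomial τ κ' := (chartQuotEquiv cc 0 hc).symm.trans E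
  have hΘ : ∀ z, Θ (Ideal.Quotient.mk _ z) = E ((chartQuotEquiv cc 0 hc).symm (Ideal.Quotient.mk _ z)) :=
    fun z => rfl
  refine ⟨Θ.toRingHom.comp (Ideal.Quotient.mk _), Θ.surjective.comp Ideal.Quotient.mk_surjective, ?_, ?_, ?_, ?_⟩
  · ext z
    change Θ (Ideal.Quotient.mk _ z) = 0 ↔ z ∈ Ideal.span {w₀}
    rw [map_eq_zero_iff _ Θ.injective, Ideal.Quotient.eq_zero_iff_mem]
  · change Θ (Ideal.Quotient.mk _ ss) = _
    rw [hΘ, hθs, hEX]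
  · change Θ (Ideal.Quotient.mk _ (ψ₀ e[1])) = _
    rw [hΘ, hθr, hE1]
  · change Θ (Ideal.Quotient.mk _ (ψ₀ e[2])) = _
    rw [hΘ, hθr, hE2]

include hx hd in
/-- **The `s`-chart `C₀` of the plane step on `B₃` is resolved** (the point step of
`…TwoPlanesPointQCharts`). [cite: StacksProject, Tag 080A] [cite: StacksProject, Tag 080B] -/
theorem isRegular_of_isBlowup_chartThree_s {Y : Scheme.{u}} {ρ : Y ⟶ Spec (.of C₀)}
    (hρ : IsBlowup ρ (affineBlowup.idealSheaf ((J * Jq₃ * Kpi₃).map ψ₀))) : Scheme.IsRegular Y := by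
  classical
  haveI : IsDomain S := isDomain_of_isRegularLocalRing S
  have hqr := isQuasiRegular_regularSystemOfParameters hd x hx
  haveI : IsRegularRing B := isRegularRing_chart x hx hd 3
  haveI := isRegularRing_residue x hx
  have hx3 : x 3 ≠ 0 := (isRsopPart_comp_of_rsop hd x hx id Function.injective_id).ne_zero 3
  haveI : IsDomain B := isDomain_chartRing x 3 hx3
  have hc : IsQuasiRegular cc :=
    isQuasiRegular_cons_chartGen x 3 (fun _ : Fin 1 => (⟨0, three_ne_zero_one.1.symm⟩ : {j : Fin 4 // j ≠ 3})) hqr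
      (Function.injective_of_subsingleton _)
  haveI : IsRegularRing (B ⧸ II) :=
    isRegularRing_quot_cons_chartGen x 3 (fun _ : Fin 1 => (⟨0, three_ne_zero_one.1.symm⟩ : {j : Fin 4 // j ≠ 3})) hqr
  have hu : uB ∈ nonZeroDivisors B :=
    reesChartBase_mem_nonZeroDivisors (x 3) (Ideal.mem_span_range_self (f := x) (x := 3))
  haveI : IsDomain C₀ := isDomain_chartRing cc 0 (nonZeroDivisors.ne_zero hu)
  haveI : IsRegularRing C₀ := isRegularRing_blowupChart cc 0 hc
  haveI : IsDomain κ' := isDomain_residue_sup_bot x hx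
  haveI : IsRegularRing κ' := isRegularRing_residue_sup_bot x hx
  obtain ⟨q, hq, hker, hqs, hq1, hq2⟩ := exists_pointQModelHom_three x hx hd
  have h01 : vS ≠ vT1 := Sum.inl_ne_inr
  have h02 : vS ≠ vT2 := Sum.inl_ne_inr
  have h12 : vT1 ≠ vT2 := fun h => absurd (congrArg Subtype.val (Sum.inr_injective h)) (by decide)
  have hι := injective_cons_three vS vT1 vT2 h01 h02 h12
  rw [map_KK_s (chartBase x 3 (x 3)) e[0] e[1] e[2]] at hρ
  exact CoreRungTower.isRegular_of_isBlowup_span_singleton_mul (pow_mem (w₀_mem_nonZeroDivisors uB e[0]) 6) _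
    (fun Y' ρ' h' => isRegular_of_isBlowup_pointQ w₀ ss (ψ₀ e[1]) (ψ₀ e[2]) q
      (Fin.cons vS (Fin.cons vT1 (Fin.cons vT2 Fin.elim0 : Fin 1 → τ) : Fin 2 → τ) : Fin 3 → τ)
      hq hker hι hqs hq1 hq2 (w₀_mem_nonZeroDivisors uB e[0]) h') hρ

include hx hd in
/-- **The `t`-chart of the plane step on `B₃` is resolved** (Cartier twist `(w)³`, then the letter
tower of `…TwoPlanesLevelTwo`). [cite: StacksProject, Tag 080A] [cite: StacksProject, Tag 080B] -/
theorem isRegular_of_isBlowup_chartThree_t {Y : Scheme.{u}} {ρ : Y ⟶ Spec (.of (chartRing cc 1))}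
    (hρ : IsBlowup ρ (affineBlowup.idealSheaf ((J * Jq₃ * Kpi₃).map (chartBase cc 1)))) :
    Scheme.IsRegular Y := by
  haveI : IsDomain S := isDomain_of_isRegularLocalRing S
  have hqr := isQuasiRegular_regularSystemOfParameters hd x hx
  have hBr : IsRegularRing B := isRegularRing_chart x hx hd 3
  haveI := isRegularRing_residue x hx
  haveI := isDomain_residue x hx
  have hx3 : x 3 ≠ 0 := (isRsopPart_comp_of_rsop hd x hx id Function.injective_id).ne_zero 3
  have hB : IsDomain B := isDomain_chartRing x 3 hx3
  have hdu : IsDomain (B ⧸ U) := isDomain_chartRing_quot_span x 3 hqr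
  have hc : IsQuasiRegular cc :=
    isQuasiRegular_cons_chartGen x 3 (fun _ : Fin 1 => (⟨0, three_ne_zero_one.1.symm⟩ : {j : Fin 4 // j ≠ 3})) hqr
      (Function.injective_of_subsingleton _)
  have hrII : IsRegularRing (B ⧸ II) :=
    isRegularRing_quot_cons_chartGen x 3 (fun _ : Fin 1 => (⟨0, three_ne_zero_one.1.symm⟩ : {j : Fin 4 // j ≠ 3})) hqr
  have hdII : IsDomain (B ⧸ II) := isDomain_quot_plane x hx hd 3 three_ne_zero_one.1
  have he : e[0] ∉ U := chartGen_notMem_span_u x hx hd 3 0 three_ne_zero_one.1.symm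
  obtain ⟨hPd, hPr, hPX⟩ := excCurveT_facts x hx hd 3 three_ne_zero_one.1 three_ne_zero_one.2
  rw [map_KK_t (chartBase x 3 (x 3)) e[0] e[1] e[2]] at hρ
  exact CoreRungTower.isRegular_of_isBlowup_span_singleton_mul
    (pow_mem (reesChartBase_mem_nonZeroDivisors (cc 1)
      (Ideal.mem_span_range_self (f := cc) (x := 1))) 3) _
    (fun Y' ρ' h' => tpPlane_chart_succ x 3 hc hB hBr hdII hrII hdu (isDomain_quot_span_e1 x hx hd 3 three_ne_zero_one.2)
      (isDomain_quot_plane_sup_e1 x hx hd 3 three_ne_zero_one.1 three_ne_zero_one.2)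
      (isDomain_quot_u_e1 x hx hd 3 three_ne_zero_one.2) (isRegularRing_quot_u_e1 x hx hd 3 three_ne_zero_one.2)
      (e1_notMem_plane x hx hd 3 three_ne_zero_one.1 three_ne_zero_one.2)
      (e0_notMem_span_e1 x hx hd 3 three_ne_zero_one.1 three_ne_zero_one.2) he
      (e0_notMem_u_sup_e1 x hx hd 3 three_ne_zero_one.1 three_ne_zero_one.2) hPd hPr hPX h') hρ

include hx hd in
/-- **THE CHART `B₃` IS RESOLVED**: every blowing up of `Spec B₃` along the image of
`𝔪ᴺ·A·J_q′·J_π·A₃·A₄·I` is regular. [cite: StacksProject, Tag 080A] [cite: StacksProject, Tag 080B]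
[cite: Liu2002, Thm. 8.1.19 (a)] [cite: GortzWedhorn2020, Prop. 13.96 (2)] -/
theorem isRegular_of_isBlowup_tpAllPi_three (N : ℕ) {Y : Scheme.{u}} {ρ : Y ⟶ Spec (.of B)}
    (hρ : IsBlowup ρ (affineBlowup.idealSheaf
      ((M ^ N * (Ideal.span {fT} ⊔ Ideal.span {x 0} * M ⊔ M ^ 3) * tpJq' * tpJpi * (Ideal.span {fT} ⊔ M ^ 3) *
        (Ideal.span {fT} ⊔ Ideal.span {x 0} * M ^ 2 ⊔ M ^ 4) * (Ideal.span {fT} ⊔ M ^ 4)).map (chartBase x 3)))) :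
    Scheme.IsRegular Y := by
  have hu : uB ∈ nonZeroDivisors B :=
    reesChartBase_mem_nonZeroDivisors (x 3) (Ideal.mem_span_range_self (f := x) (x := 3))
  have h0 := fun (Y' : Scheme.{u}) (ρ' : Y' ⟶ Spec (.of C₀))
      (h' : IsBlowup ρ' (affineBlowup.idealSheaf ((J * Jq₃ * Kpi₃).map ψ₀))) =>
    isRegular_of_isBlowup_chartThree_s x hx hd h'
  have h1 := fun (Y' : Scheme.{u}) (ρ' : Y' ⟶ Spec (.of (chartRing cc 1)))
      (h' : IsBlowup ρ' (affineBlowup.idealSheaf ((J * Jq₃ * Kpi₃).map (chartBase cc 1)))) =>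
    isRegular_of_isBlowup_chartThree_t x hx hd h'
  have hcharts : ∀ (k : Fin 2) (Y' : Scheme.{u}) (ρ' : Y' ⟶ Spec (.of (chartRing cc k))),
      IsBlowup ρ' (affineBlowup.idealSheaf ((J * Jq₃ * Kpi₃).map (chartBase cc k))) → Scheme.IsRegular Y' :=
    Fin.forall_fin_two.mpr ⟨h0, h1⟩
  rw [map_tpAllPi_three] at hρ
  exact CoreRungTower.isRegular_of_isBlowup_span_singleton_mul (pow_mem hu (N + 11)) _
    (fun Y' ρ' h' => isRegular_of_isBlowup_mul_of_charts cc (J * Jq₃ * Kpi₃) hcharts h') hρ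

end ChartThree

end TwoPlanesRung

end Summit.ResolutionOfSingularities.ResolutionOfSingularities.Theorems

end
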